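import Summits.QuantumAdvantage.QuantumAdvantage.Theorems.LinnikCubicClassGroupsDegreeOnePrimesEscapeFrobeniusWindowDHCore
import Summits.QuantumAdvantage.QuantumAdvantage.Theorems.LinnikCubicClassGroupsDegreeOnePrimesEscapeClassPNTDHInputs
import HarnessLib

/-!
# The Deuring-twisted window explicit formula of a cyclic `N|E`: the dichotomy WITH Deuring–Heilbronn

Topic `Summits/QuantumAdvantage/QuantumAdvantage/Theorems`, cell B2b-1 (linnik-cubic), PART A (gen 17); helper toward
the crux `DegreeOnePrimesEscape` (stmt-QuantumAdvantage-11543) — the CHEBOTAREV DENSITY THEOREM IN SHORT INTERVALS for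
conjugacy classes with RELATIVE error in the flat regime.  HONEST FRAMING: value = THEOREM — NOT summit progress.

`frobWindow_dichotomy_dh` = `frobWindow_dichotomy` + the Deuring–Heilbronn repulsion (`hDH`, discharged downstream by
`deuringHeilbronn`): in case (B) the error is `κ x η · min(1, (1 − β₁) log x)`, with a collar ratio `ε₀ ≥ e₀Q^{−2}` chosen
after the field.  Hoheisel's flat part at `T₁ = X^θ` with the classical zero-free region when `μ₁ = (1−β₁)log x ≥ c_u` and
the repelled one (`zfr_of_zeroRepulsion`) when `μ₁ < c_u` (`dh_flat_le`); Stark's `1 − β₁ ≥ c₁Q^{−2}` absorbs the junk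
(`dh_junk_le`).  Short-interval form of the unified Chebotarev theorem [ThornerZaman2019, Thm. 1.1/3.1]; the printed
short-interval statements (Balog–Ono 2001, Gun–Naik 2024 Thm. 7) have an absolute error.
References: [LagariasMontgomeryOdlyzko1979, §7]; [ThornerZaman2019, Thm. 3.1, §5]; G. Hoheisel (1930). -/

noncomputable section

open Complex Real MeasureTheory Set Filter Topology NumberField NumberField.InfinitePlace IsDedekindDomain
open scoped NumberField nonZeroDivisors

namespace Summit.QuantumAdvantage.QuantumAdvantage.Theorems.DegreeOnePrimesEscape

open Literature.NumberTheory.LFunctions Literature.NumberTheory.LFunctions.NumberField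
  Literature.NumberTheory.LFunctions.EntireEF Literature.NumberTheory.LFunctions.WindowWeight
  Literature.NumberTheory.LFunctions.AbelianDensity

set_option maxHeartbeats 3200000 in
/-- **The smoothed Frobenius-weighted window dichotomy, Deuring–Heilbronn form** (see the module docstring):
(A) error `κ x η` without a zero in the `c`-window; (B) error `κ x η min(1, (1−β₁) log x)` with one. -/
theorem frobWindow_dichotomy_dh (n₀ : ℕ) (hn₀ : 1 < n₀) {b D a : ℝ} (hb : 0 < b) (hD : 0 < D) (ha : 1 ≤ a)
    {κ : ℝ} (hκ : 0 < κ) {e₀ : ℝ} (he₀ : 0 < e₀) (he₀1 : e₀ ≤ 1 / 4)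
    (hDH : ∃ C : ℝ, 0 < C ∧ ∀ (K : Type) [Field K] [NumberField K] (χ₁ : ClassGroup (𝓞 K) →* ℂˣ),
      χ₁ * χ₁ = 1 → ∀ β₁ : ℝ, 0 < β₁ → β₁ < 1 → classGroupLFunction K χ₁ β₁ = 0 →
      ∀ (χ : ClassGroup (𝓞 K) →* ℂˣ) (ρ : ℂ), classGroupLFunction K χ ρ = 0 → 1 / 2 ≤ ρ.re → ρ ≠ 1 →
        ρ ≠ β₁ →
        Real.log (1 / (C * (Real.log ((NumberField.discr K).natAbs : ℝ) +
            Module.finrank ℚ K * (Real.log (|ρ.im| + 2) + 1)) * (1 - β₁))) /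
          (C * (Real.log ((NumberField.discr K).natAbs : ℝ) +
            Module.finrank ℚ K * (Real.log (|ρ.im| + 2) + 1))) ≤ 1 - ρ.re) :
    ∃ θ a₁ c : ℝ, 0 < θ ∧ θ ≤ 1 / 8 ∧ 1 ≤ a₁ ∧ 0 < c ∧ c ≤ 1 / (8 * ((n₀ : ℝ) ^ 2 + 1)) ∧
    ∀ (E N : Type) [Field E] [NumberField E] [Field N] [NumberField N] [Algebra E N],
      Module.finrank ℚ N = n₀ →
      (∀ (T : ℝ), 1 ≤ T → ∀ u : AddChar (Additive (ClassGroup (𝓞 N))) ℂ → Finset ℂ,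
        (∀ ψ, ∀ ρ ∈ u ψ, famF N ψ ρ = 0 ∧ 1 / 4 ≤ ρ.re ∧ ρ.re < 1 ∧ |ρ.im| ≤ T) →
        ∀ α : ℝ, α ≤ 1 →
          ∑ ψ, ∑ ρ ∈ u ψ with α ≤ ρ.re, (famMult N ψ ρ : ℝ) ≤
            D * Real.exp (b * (a * Real.log (ThornerZaman.condQn N) + Real.log (T + 4))) ^ (1 - α)) →
      ∀ (m : ℕ), 1 ≤ m → Module.finrank ℚ N = Module.finrank ℚ E * m →
      ∀ (𝔣 : ℕ → Ideal (𝓞 E)) (χ : ℕ → HeightOneSpectrum (𝓞 E) → ℂ)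
        (p : ℕ → Finset {w : InfinitePlace E // w.IsReal}) (L L' : ℕ → ℂ → ℂ),
      (∀ j, 𝔣 j ≠ ⊥ ∧ IsRayClassCharacter (𝔣 j) (χ j) ∧ IsPrimitive (𝔣 j) (χ j) ∧ IsSignType (𝔣 j) (χ j) (p j)) →
      (∀ j ∈ Finset.Ico 1 m, ∃ v : HeightOneSpectrum (𝓞 E), ¬ 𝔣 j ≤ v.asIdeal ∧ χ j v ≠ 1) →
      (∀ j ∈ Finset.Ico 1 m, Differentiable ℂ (L j) ∧ ∀ s : ℂ, 1 < s.re → L j s = rayClassLSeries (𝔣 j) (χ j) s) →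
      (∀ j ∈ Finset.Ico 1 m, Differentiable ℂ (L' j) ∧
        ∀ s : ℂ, 1 < s.re → L' j s = rayClassLSeries (𝔣 j) (star (χ j)) s) →
      (∀ ρ : ℂ, analyticOrderNatAt (dedekindZeta₁ N) ρ =
        analyticOrderNatAt (dedekindZeta₁ E) ρ + ∑ j ∈ Finset.Ico 1 m, analyticOrderNatAt (L j) ρ) →
      𝔣 0 = ⊤ → (∀ v, χ 0 v = 1) →
      (∀ j ∈ Finset.Ico 1 m, |(NumberField.discr E : ℝ)| * (Ideal.absNorm (𝔣 j) : ℝ) ≤ (NumberField.discr N).natAbs) →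
      ((NumberField.discr E).natAbs : ℝ) ≤ (NumberField.discr N).natAbs →
      ∀ ε₀ : ℝ, e₀ * ThornerZaman.condQn N ^ (-(2 : ℝ)) ≤ ε₀ → ε₀ ≤ 1 / 4 →
      ∀ x η : ℝ, ThornerZaman.condQn N ^ a₁ ≤ x → 0 < η → η ≤ Real.log 2 →
        Real.exp (-(θ / 8) * Real.log x) ≤ 2 * η →
      ∀ lo hi : ℝ, Real.log x ≤ lo → lo < hi → hi ≤ Real.log x + η →
      (∀ (cc : ℂ), ‖cc‖ ≤ 1 →
          (¬ ∃ β₁ : ℝ, dedekindZeta₁ N β₁ = 0 ∧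
            1 - c / (Real.log ((NumberField.discr N).natAbs : ℝ) + Real.log 4) < β₁ ∧ β₁ < 1) →
          ‖∑ j ∈ Finset.range m, cc ^ j * coefFordK (rcCoef (𝔣 j) (χ j)) (windowTest lo hi (ε₀ * η)) 0 -
              fordLaplace (windowTest lo hi (ε₀ * η)) (-1)‖ ≤ κ * x * η) ∧
      (∀ β₁ : ℝ, dedekindZeta₁ N β₁ = 0 →
          1 - c / (Real.log ((NumberField.discr N).natAbs : ℝ) + Real.log 4) < β₁ → β₁ < 1 →
        ∃ j₀ : ℕ, j₀ < m ∧
          ((j₀ = 0 ∧ analyticOrderNatAt (dedekindZeta₁ E) β₁ = 1) ∨ (0 < j₀ ∧ analyticOrderNatAt (L j₀) β₁ = 1)) ∧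
          ∀ (cc : ℂ), ‖cc‖ ≤ 1 →
            ‖∑ j ∈ Finset.range m, cc ^ j * coefFordK (rcCoef (𝔣 j) (χ j)) (windowTest lo hi (ε₀ * η)) 0 -
                fordLaplace (windowTest lo hi (ε₀ * η)) (-1) +
                cc ^ j₀ * fordLaplace (windowTest lo hi (ε₀ * η)) (-(β₁ : ℂ))‖ ≤
              κ * x * η * min 1 ((1 - β₁) * Real.log x)) := by
  classical
  obtain ⟨c₀, hc₀, hpackAll⟩ := exists_exceptionalZero_const n₀
  obtain ⟨Al, hAl0, hAl⟩ := exists_norm_logDeriv_classGroupLFunction_left_le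
  obtain ⟨Cr, hCr0, hCr⟩ := exists_norm_logDeriv_continuation_left_le
  obtain ⟨M, hM1, hM⟩ := TZWeight.exists_smoothTransition_deriv_bound
  obtain ⟨hc₁16, hc₂0⟩ := tailConst_nonneg
  obtain ⟨C, hC, hDH'⟩ := hDH
  obtain ⟨c₁, hc₁, hc₁1, heff⟩ := Residue.one_sub_realZero_ge_condQn_rpow n₀ hn₀
  have hlC := leftLineConst_nonneg
  have hn2 : (2 : ℝ) ≤ n₀ := by exact_mod_cast hn₀
  have hn0 : (0 : ℝ) < n₀ := by linarith
  have hM0 : 0 ≤ M := by linarith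
  have hAC0 : 0 < max Al Cr := lt_max_of_lt_left hAl0
  set c : ℝ := min c₀ (1 / (8 * ((n₀ : ℝ) ^ 2 + 1))) with hcdef
  have hc : 0 < c := lt_min hc₀ (by positivity)
  have hcc₀ : c ≤ c₀ := min_le_left _ _
  have hcn : c ≤ 1 / (8 * ((n₀ : ℝ) ^ 2 + 1)) := min_le_right _ _
  set cu : ℝ := min 1 (1 / (6 * C * n₀)) with hcu
  have hcu0 : 0 < cu := lt_min one_pos (by positivity)
  have hcu1 : cu ≤ 1 := min_le_left _ _
  have hcuC : cu ≤ 1 / (6 * C * n₀) := min_le_right _ _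
  set tA : ℝ := κ * cu / (9 * n₀) with htA
  set tB : ℝ := κ / (9 * n₀) with htB
  have htA0 : 0 < tA := by positivity
  have htB0 : 0 < tB := by positivity
  -- the exponent `θ`
  set ΛA : ℝ := Real.log (2 * Real.exp 1 * D / tA + 3) with hΛA
  have hΛAarg : 1 < 2 * Real.exp 1 * D / tA + 3 := by
    have : 0 < 2 * Real.exp 1 * D / tA := by positivity
    linarith
  have hΛA0 : 0 < ΛA := Real.log_pos hΛAarg
  set K₃ : ℝ := 2 + max 0 (Real.log (4 * Real.exp 1 * D * C * n₀ / tB)) / Real.log 3 with hK₃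
  set K₄ : ℝ := 2 + max 0 (Real.log (2 * Real.exp 1 * D / (tB * c₁))) / Real.log 12 with hK₄
  have hlog3 : 0 < Real.log 3 := Real.log_pos (by norm_num)
  have hlog12 : 0 < Real.log 12 := Real.log_pos (by norm_num)
  have hK₃0 : 2 ≤ K₃ := by
    have : 0 ≤ max 0 (Real.log (4 * Real.exp 1 * D * C * n₀ / tB)) / Real.log 3 := by positivity
    linarith
  have hK₄0 : 2 ≤ K₄ := by
    have : 0 ≤ max 0 (Real.log (2 * Real.exp 1 * D / (tB * c₁))) / Real.log 12 := by positivity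
    linarith
  set θ : ℝ := min (min (1 / (8 * b)) (1 / 8)) (min (c / (6 * ΛA)) (min (1 / (6 * C * n₀ * K₃)) (a / (12 * K₄))))
    with hθ
  have hθ0 : 0 < θ := by positivity
  have hθb : θ * b ≤ 1 / 8 := by
    have h1 : θ ≤ 1 / (8 * b) := (min_le_left _ _).trans (min_le_left _ _)
    calc θ * b ≤ 1 / (8 * b) * b := mul_le_mul_of_nonneg_right h1 hb.le
      _ = 1 / 8 := by field_simp
  have hθ1 : θ ≤ 1 / 8 := (min_le_left _ _).trans (min_le_right _ _)
  have hθΛ : θ ≤ c / (6 * ΛA) := (min_le_right _ _).trans (min_le_left _ _)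
  have hθK₃ : θ ≤ 1 / (6 * C * n₀ * K₃) := (min_le_right _ _).trans ((min_le_right _ _).trans (min_le_left _ _))
  have hθK₄ : θ ≤ a / (12 * K₄) := (min_le_right _ _).trans ((min_le_right _ _).trans (min_le_right _ _))
  have hflatA : 2 * Real.exp 1 * D * Real.exp (-(c / (6 * θ))) ≤ tA :=
    flat_le_of_theta_le hD hθ0 htA0 (by rw [← hΛA]; exact hθΛ)
  have hθK₃' : 6 * θ * C * n₀ * (2 + max 0 (Real.log (4 * Real.exp 1 * D * C * n₀ / tB)) / Real.log 3) ≤ 1 := by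
    rw [← hK₃]
    have := (le_div_iff₀ (by positivity : (0:ℝ) < 6 * C * n₀ * K₃)).1 hθK₃
    linarith
  have hθK₄' : 12 * θ * (2 + max 0 (Real.log (2 * Real.exp 1 * D / (tB * c₁))) / Real.log 12) ≤ a := by
    rw [← hK₄]
    have := (le_div_iff₀ (by positivity : (0:ℝ) < 12 * K₄)).1 hθK₄
    linarith
  -- the absorption constant and the threshold
  set W₀ : ℝ := 512 * ((n₀ : ℝ) + 1) with hW₀
  have hW₀0 : 0 < W₀ := by positivity
  set CJ : ℝ := 338 * W₀ + 96 * (M / (4 * e₀)) * W₀ * (4 * tailConst₁ + tailConst₂) + 108 +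
    640 * leftLineConst * (max Al Cr) * (M / (4 * e₀)) with hCJ
  have hc₁0 : 0 ≤ tailConst₁ := by linarith
  have hCJ0 : 0 ≤ CJ := by rw [hCJ]; positivity
  obtain ⟨a₁', ha₁'1, habsAll⟩ := absorb_junk (2 * n₀ * CJ / (κ * c₁)) (θ / 2) (by positivity) (by positivity)
    (by linarith)
  set a₁ : ℝ := max (max a₁' (32 / θ)) (max (a / θ) 64) with ha₁
  have ha₁a' : a₁' ≤ a₁ := le_trans (le_max_left _ _) (le_max_left _ _)
  have ha₁32 : 32 / θ ≤ a₁ := le_trans (le_max_right _ _) (le_max_left _ _)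
  have ha₁aθ : a / θ ≤ a₁ := le_trans (le_max_left _ _) (le_max_right _ _)
  have ha₁64 : (64 : ℝ) ≤ a₁ := le_trans (le_max_right _ _) (le_max_right _ _)
  have ha₁1 : 1 ≤ a₁ := by linarith
  refine ⟨θ, a₁, c, hθ0, hθ1, ha₁1, hc, hcn, ?_⟩
  intro E N _ _ _ _ _ hNn hdens m hm1 hdeg 𝔣 χ p L L' hdata hnt hL hL' hord h𝔣0 hχ0 hcond hdE ε₀ hε₀Q hε₀1
    x η hx hη0 hη1 hηx lo hi hlo hlohi hhi
  have hN : 1 < Module.finrank ℚ N := by rw [hNn]; exact hn₀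
  have hQ12 : (12 : ℝ) ≤ ThornerZaman.condQn N := ThornerZaman.twelve_le_condQn (K := N) hN
  have hQ1 : (1 : ℝ) < ThornerZaman.condQn N := by linarith
  have hQ0 : (0 : ℝ) < ThornerZaman.condQn N := by linarith
  obtain ⟨-, -, hlog12'⟩ := log_small_consts
  have hlogQ : 2 ≤ Real.log (ThornerZaman.condQn N) := hlog12'.trans (Real.log_le_log (by norm_num) hQ12)
  have hQm2pos : 0 < ThornerZaman.condQn N ^ (-(2 : ℝ)) := Real.rpow_pos_of_pos hQ0 _
  have hQm2le : ThornerZaman.condQn N ^ (-(2 : ℝ)) ≤ 1 := Real.rpow_le_one_of_one_le_of_nonpos hQ1.le (by norm_num)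
  have hε₀0 : 0 < ε₀ := lt_of_lt_of_le (mul_pos he₀ hQm2pos) hε₀Q
  have hmn₀ : (m : ℝ) ≤ n₀ := by
    have : m ≤ n₀ := by rw [← hNn, hdeg]; exact Nat.le_mul_of_pos_left m Module.finrank_pos
    exact_mod_cast this
  have hm0 : (0 : ℝ) ≤ m := Nat.cast_nonneg _
  have hnEn₀ : (Module.finrank ℚ E : ℝ) ≤ n₀ := by
    have : Module.finrank ℚ E ≤ n₀ := by rw [← hNn, hdeg]; exact Nat.le_mul_of_pos_right _ hm1
    exact_mod_cast this
  have hxa₁' : ThornerZaman.condQn N ^ a₁' ≤ x :=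
    (Real.rpow_le_rpow_of_exponent_le hQ1.le ha₁a').trans hx
  have hxaθ : ThornerZaman.condQn N ^ (a / θ) ≤ x :=
    (Real.rpow_le_rpow_of_exponent_le hQ1.le ha₁aθ).trans hx
  have hx32 : ThornerZaman.condQn N ^ (32 / θ) ≤ x :=
    (Real.rpow_le_rpow_of_exponent_le hQ1.le ha₁32).trans hx
  have hQx : ThornerZaman.condQn N ≤ x := by
    have := (Real.rpow_le_rpow_of_exponent_le hQ1.le ha₁1).trans hx
    rwa [Real.rpow_one] at this
  have hx1 : 1 < x := by linarith
  have hx0 : 0 < x := by linarith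
  have hL0 : 0 < Real.log x := Real.log_pos hx1
  have hxexp : Real.exp (Real.log x) = x := Real.exp_log hx0
  have hLQ : a₁ * Real.log (ThornerZaman.condQn N) ≤ Real.log x := by
    have := Real.log_le_log (by positivity) hx
    rwa [Real.log_rpow (by linarith)] at this
  have hL64 : 64 ≤ Real.log x := by nlinarith
  have haθ : a * Real.log (ThornerZaman.condQn N) ≤ θ * Real.log x := by
    have h1 := Real.log_le_log (by positivity) hxaθ
    rw [Real.log_rpow (by linarith)] at h1
    have h2 : θ * (a / θ * Real.log (ThornerZaman.condQn N)) = a * Real.log (ThornerZaman.condQn N) := by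
      field_simp
    have h3 := mul_le_mul_of_nonneg_left h1 hθ0.le
    linarith
  have h2θ : 2 ≤ θ * Real.log x := by
    have := mul_le_mul ha hlogQ (by norm_num) (by linarith : (0 : ℝ) ≤ a)
    linarith
  -- the junk: `n₀ κ₂ ≤ (κ c₁/2) Q^{-2}`
  have hQ4 : ThornerZaman.condQn N ^ (4 : ℕ) * x ^ (-(θ / 8)) ≤ 1 := pow_four_mul_rpow_le_one hQ0 hx0 hθ0 hx32
  have habs' := habsAll (ThornerZaman.condQn N) x hQ12 hxa₁'
  rw [show -(θ / 2 / 4) = -(θ / 8) by ring] at habs'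
  have hjunk : (n₀ : ℝ) * ((338 * W₀ + 96 * (M / (4 * ε₀)) * W₀ * (4 * tailConst₁ + tailConst₂) + 108 +
      640 * leftLineConst * (max Al Cr) * (M / (4 * ε₀))) * ThornerZaman.condQn N ^ (7 : ℕ) * (Real.log x + 1) *
      Real.exp (-(θ / 4) * Real.log x)) ≤ κ * c₁ / 2 * ThornerZaman.condQn N ^ (-(2 : ℝ)) :=
    dh_junk_le hn0 hW₀0.le hM0 hc₁0 hc₂0 hlC hAC0.le he₀ hε₀Q hQ12 hx0 hκ hc₁ (by rw [← hCJ]; exact habs') hQ4 hL0.le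
  -- the window and the height `T₁ = X^θ ≤ x`
  set ε : ℝ := ε₀ * η with hε
  have hlog2 : Real.log 2 < 0.6931471808 := Real.log_two_lt_d9
  have hLX0 : 0 ≤ hi + ε := by
    have : 0 < ε := by positivity
    linarith
  have hT₁x : Real.exp (θ * (hi + ε)) ≤ x := by
    rw [← hxexp]
    refine Real.exp_le_exp.2 ?_
    have h1 : θ * (hi + ε) ≤ 1 / 8 * (hi + ε) := mul_le_mul_of_nonneg_right hθ1 hLX0
    have hε1 : ε ≤ 1 := by rw [hε]; have := mul_le_mul hε₀1 hη1 hη0.le (by norm_num); linarith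
    linarith [hL64]
  have hlogd0 : 0 ≤ Real.log ((NumberField.discr N).natAbs : ℝ) := Real.log_natCast_nonneg _
  have hlog4 : 0 ≤ Real.log 4 := Real.log_nonneg (by norm_num)
  -- the Landau–Page package of `N`
  obtain ⟨hLPreal, hLPuniq, hLPsimple⟩ := hpackAll N hNn
  have hpack_c := pack_of_le (K := N) hcc₀ hLPreal
  have hexcZ : ∀ ρ, dedekindZeta₁ N ρ = 0 → excRegion c N ρ →
      (((1 : ClassGroup (𝓞 N) →* ℂˣ) = 1 → dedekindZeta₁ N ρ = 0) ∧
        ((1 : ClassGroup (𝓞 N) →* ℂˣ) ≠ 1 → classGroupLFunction₀ N 1 ρ = 0)) ∧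
        1 - c₀ / (Real.log ((NumberField.discr N).natAbs : ℝ) + Real.log (|ρ.im| + 4)) < ρ.re := fun ρ h0 hexc ↦
    ⟨⟨fun _ ↦ h0, fun h ↦ absurd rfl h⟩, lpRegion_mono hcc₀ (by rw [hexc.1, abs_zero, zero_add]; exact hexc.2)⟩
  -- the classical zero-free region off the exceptional segment, in `Q`-form
  have hzfr_c := zfr_classical_of_pack (N := N) hc ha hpack_c (T := Real.exp (θ * (hi + ε)))
  -- the core estimate with a zero-free constant `cZ` (`…FrobeniusWindowDHCore.lean`)
  rw [hW₀] at hjunk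
  have hcore : ∀ (cZ : ℝ), 0 < cZ →
      (∀ (ψ : AddChar (Additive (ClassGroup (𝓞 N))) ℂ) (ρ : ℂ), famF N ψ ρ = 0 → 1 / 4 ≤ ρ.re →
        ρ.re < 1 → |ρ.im| ≤ Real.exp (θ * (hi + ε₀ * η)) → ¬ excRegion c N ρ →
          ρ.re ≤ 1 - cZ / (a * Real.log (ThornerZaman.condQn N) + Real.log (|ρ.im| + 4))) →
      ∀ (cc : ℂ), ‖cc‖ ≤ 1 → ∀ (Exc : ℕ → Finset ℂ),
      (∀ ρ ∈ Exc 0, famF E 0 ρ = 0 ∧ 0 < ρ.re ∧ ρ.re < 1) →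
      (∀ j ∈ Finset.Ico 1 m, ∀ ρ ∈ Exc j, L j ρ = 0 ∧ 0 < ρ.re ∧ ρ.re < 1) →
      (∀ ρ, dedekindZeta₁ N ρ = 0 → 0 < ρ.re → ρ.re < 1 → excRegion c N ρ →
        (famF E 0 ρ = 0 → ρ ∈ Exc 0) ∧ ∀ j ∈ Finset.Ico 1 m, L j ρ = 0 → ρ ∈ Exc j) →
      ‖∑ j ∈ Finset.range m, cc ^ j * coefFordK (rcCoef (𝔣 j) (χ j)) (windowTest lo hi (ε₀ * η)) 0 -
          fordLaplace (windowTest lo hi (ε₀ * η)) (-1) +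
          (∑ ρ ∈ Exc 0, (famMult E 0 ρ : ℂ) * fordLaplace (windowTest lo hi (ε₀ * η)) (-ρ) +
            ∑ j ∈ Finset.Ico 1 m, cc ^ j *
              ∑ ρ ∈ Exc j, (analyticOrderNatAt (L j) ρ : ℂ) * fordLaplace (windowTest lo hi (ε₀ * η)) (-ρ))‖ ≤
        ((n₀ : ℝ) * (9 / 2 * (2 * Real.exp 1 * D * Real.exp (-(cZ / (6 * θ))))) +
          κ * c₁ / 2 * ThornerZaman.condQn N ^ (-(2 : ℝ))) * x * η :=
    fun cZ hcZ hzfr cc hcc Exc hExc0 hExcj hExc' ↦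
      frobWindow_core_dh n₀ hn₀ hb hD ha c hcZ hAl0 hAl hCr0 hCr hM hM1 E N hNn hdens m hm1 hdeg 𝔣 χ p L L' hdata hnt
        hL hL' hord h𝔣0 hχ0 hcond hdE hθ0 hθb hθ1 hx1 haθ h2θ hη0 hη1 hηx hlo hlohi hhi hε₀0 hε₀1 hjunk hzfr cc hcc
        Exc hExc0 hExcj hExc'
  clear habsAll
  -- THE DICHOTOMY
  refine ⟨fun cc hcc hnoexc ↦ ?_, fun β₁ hζβ hβwin hβ1 ↦ ?_⟩
  · -- (A) no exceptional zero of `ζ₁_N`: classical zero-free region, target `κ`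
    have hex : ¬ ∃ ρ : ℂ, dedekindZeta₁ N ρ = 0 ∧ 0 < ρ.re ∧ ρ.re < 1 ∧ excRegion c N ρ := by
      rintro ⟨ρ, h0, h1, h2, hexc⟩
      obtain ⟨him, -⟩ := hLPreal 1 ρ (hexcZ ρ h0 hexc)
      have hρ : ρ = (ρ.re : ℂ) := by apply Complex.ext <;> simp [him]
      exact hnoexc ⟨ρ.re, by rw [← hρ]; exact h0, hexc.2, h2⟩
    have key := hcore c hc hzfr_c cc hcc (fun _ ↦ ∅) (fun ρ hρ ↦ by simp at hρ) (fun j _ ρ hρ ↦ by simp at hρ)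
      (fun ρ h0 h1 h2 hexc ↦ absurd ⟨ρ, h0, h1, h2, hexc⟩ hex)
    simp only [Finset.sum_empty, mul_zero, Finset.sum_const_zero, add_zero] at key
    refine key.trans ?_
    have h1 : (n₀ : ℝ) * (9 / 2 * (2 * Real.exp 1 * D * Real.exp (-(c / (6 * θ))))) ≤ κ / 2 := by
      have h3 := mul_le_mul_of_nonneg_left hflatA (by positivity : (0 : ℝ) ≤ (n₀ : ℝ) * (9 / 2))
      have e : (n₀ : ℝ) * (9 / 2) * tA = κ * cu / 2 := by rw [htA]; field_simp
      have h4 : κ * cu ≤ κ * 1 := mul_le_mul_of_nonneg_left hcu1 hκ.le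
      linarith
    have h2 : κ * c₁ / 2 * ThornerZaman.condQn N ^ (-(2 : ℝ)) ≤ κ / 2 := by
      have h3 := mul_le_mul hc₁1 hQm2le hQm2pos.le zero_le_one
      have h4 := mul_le_mul_of_nonneg_left h3 (by positivity : (0 : ℝ) ≤ κ / 2)
      linarith
    have hsum : (n₀ : ℝ) * (9 / 2 * (2 * Real.exp 1 * D * Real.exp (-(c / (6 * θ))))) +
        κ * c₁ / 2 * ThornerZaman.condQn N ^ (-(2 : ℝ)) ≤ κ := by linarith
    exact mul_le_mul_of_nonneg_right (mul_le_mul_of_nonneg_right hsum hx0.le) hη0.le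
  · -- (B) an exceptional zero `β₁` of `ζ₁_N`: real, unique, simple
    have hZ₁ : (((1 : ClassGroup (𝓞 N) →* ℂˣ) = 1 → dedekindZeta₁ N β₁ = 0) ∧
        ((1 : ClassGroup (𝓞 N) →* ℂˣ) ≠ 1 → classGroupLFunction₀ N 1 β₁ = 0)) ∧
        1 - c₀ / (Real.log ((NumberField.discr N).natAbs : ℝ) + Real.log (|(β₁ : ℂ).im| + 4)) < (β₁ : ℂ).re := by
      refine ⟨⟨fun _ ↦ hζβ, fun h ↦ absurd rfl h⟩, lpRegion_mono hcc₀ ?_⟩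
      rw [Complex.ofReal_im, abs_zero, zero_add, Complex.ofReal_re]; exact hβwin
    have hexcβ : excRegion c N (β₁ : ℂ) := ⟨Complex.ofReal_im β₁, by rw [Complex.ofReal_re]; exact hβwin⟩
    have hmult : analyticOrderNatAt (dedekindZeta₁ N) β₁ = 1 := by
      obtain ⟨hs1, -⟩ := hLPsimple 1 (β₁ : ℂ) hZ₁
      have h := hs1 rfl
      have hne : analyticOrderAt (dedekindZeta₁ N) β₁ ≠ ⊤ := by rw [h]; exact ENat.one_ne_top
      have : (analyticOrderNatAt (dedekindZeta₁ N) β₁ : ℕ∞) = 1 := by rw [Nat.cast_analyticOrderNatAt hne, h]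
      exact_mod_cast this
    have hβhalf : 1 / 2 ≤ β₁ := half_le_of_window (N := N) hcn hβwin
    have hβ0 : 0 < β₁ := by linarith
    have hβ1ne : ((β₁ : ℝ) : ℂ) ≠ 1 := by
      intro h'; apply hβ1.ne; exact_mod_cast h'
    have hLzero : classGroupLFunction N 1 β₁ = 0 := by
      have := classGroupLFunction_eq_zero_of_famF (K := N) 0 (ρ := (β₁ : ℂ)) (by rw [famF_zero]; exact hζβ) hβ1ne
      rwa [toHomUnits_toMulHom_zero] at this
    have h11 : (1 : ClassGroup (𝓞 N) →* ℂˣ) * 1 = 1 := by ext; simp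
    have hδlow : c₁ * ThornerZaman.condQn N ^ (-(2 : ℝ)) ≤ 1 - β₁ := heff N hNn 1 h11 β₁ hβ1 hLzero
    have hrep := hDH' N 1 h11 β₁ hβ0 hβ1 hLzero
    -- the index `j₀` carrying `β₁`
    have hsum1 : analyticOrderNatAt (dedekindZeta₁ E) β₁ + ∑ j ∈ Finset.Ico 1 m, analyticOrderNatAt (L j) β₁ = 1 := by
      rw [← hord]; exact hmult
    -- the exceptional sets
    obtain ⟨Exc, hExc0, hExcj, hExc', hcorr⟩ := excSets_of_unique_zero (E := E) (N := N) (m := m) L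
      (fun j hj ↦ (hL j hj).1) (c := c) hβ0 hβ1 (fun ρ h0 _ _ hexc ↦
        (hLPuniq 1 1 ρ (β₁ : ℂ) (hexcZ ρ h0 hexc) hZ₁).2)
    obtain ⟨j₀, hj₀m, hj₀carrier, hθcc⟩ := exists_carrier_index (o := fun j ↦ analyticOrderNatAt (L j) β₁) hm1 hsum1
    refine ⟨j₀, hj₀m, hj₀carrier, fun cc hcc ↦ ?_⟩
    have hcorr' : ∑ ρ ∈ Exc 0, (famMult E 0 ρ : ℂ) * fordLaplace (windowTest lo hi ε) (-ρ) +
        ∑ j ∈ Finset.Ico 1 m, cc ^ j *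
          ∑ ρ ∈ Exc j, (analyticOrderNatAt (L j) ρ : ℂ) * fordLaplace (windowTest lo hi ε) (-ρ) =
        cc ^ j₀ * fordLaplace (windowTest lo hi ε) (-(β₁ : ℂ)) := by
      rw [hcorr cc, hθcc cc]
    -- sizes of `μ₁ = (1 − β₁) log x`
    have hδ₁0 : 0 < 1 - β₁ := by linarith
    have hμ0 : 0 < (1 - β₁) * Real.log x := mul_pos hδ₁0 hL0
    have hL1 : 1 ≤ Real.log x := by linarith
    have hδμ : 1 - β₁ ≤ (1 - β₁) * Real.log x := by
      have := mul_le_mul_of_nonneg_left hL1 hδ₁0.le; rw [mul_one] at this; exact this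
    have hμlow : c₁ * ThornerZaman.condQn N ^ (-(2 : ℝ)) ≤ (1 - β₁) * Real.log x := hδlow.trans hδμ
    have hμlow1 : c₁ * ThornerZaman.condQn N ^ (-(2 : ℝ)) ≤ 1 :=
      (mul_le_mul hc₁1 hQm2le hQm2pos.le zero_le_one).trans (by norm_num)
    have hμm : c₁ * ThornerZaman.condQn N ^ (-(2 : ℝ)) ≤ min 1 ((1 - β₁) * Real.log x) := le_min hμlow1 hμlow
    have hmin0 : 0 ≤ min 1 ((1 - β₁) * Real.log x) := le_min zero_le_one hμ0.le
    have hxη : 0 ≤ x * η := by positivity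
    rcases le_or_gt cu ((1 - β₁) * Real.log x) with hA | hB
    · -- regime A: the classical zero-free region suffices
      have key := hcore c hc hzfr_c cc hcc Exc hExc0 hExcj hExc'
      rw [hcorr'] at key
      refine key.trans ?_
      have hmcu : cu ≤ min 1 ((1 - β₁) * Real.log x) := le_min hcu1 hA
      have h1 : (n₀ : ℝ) * (9 / 2 * (2 * Real.exp 1 * D * Real.exp (-(c / (6 * θ))))) ≤
          κ / 2 * min 1 ((1 - β₁) * Real.log x) := by
        have h3 := mul_le_mul_of_nonneg_left hflatA (by positivity : (0 : ℝ) ≤ (n₀ : ℝ) * (9 / 2))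
        have e : (n₀ : ℝ) * (9 / 2) * tA = κ / 2 * cu := by rw [htA]; field_simp
        have h4 := mul_le_mul_of_nonneg_left hmcu (by positivity : (0:ℝ) ≤ κ / 2)
        linarith
      have h2 : κ * c₁ / 2 * ThornerZaman.condQn N ^ (-(2 : ℝ)) ≤ κ / 2 * min 1 ((1 - β₁) * Real.log x) := by
        have := mul_le_mul_of_nonneg_left hμm (by positivity : (0:ℝ) ≤ κ / 2)
        linarith
      have hsum : (n₀ : ℝ) * (9 / 2 * (2 * Real.exp 1 * D * Real.exp (-(c / (6 * θ))))) +
          κ * c₁ / 2 * ThornerZaman.condQn N ^ (-(2 : ℝ)) ≤ κ * min 1 ((1 - β₁) * Real.log x) := by linarith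
      have := mul_le_mul_of_nonneg_right (mul_le_mul_of_nonneg_right hsum hx0.le) hη0.le
      refine this.trans (le_of_eq ?_)
      ring
    · -- regime B: Deuring–Heilbronn
      have hμ1 : (1 - β₁) * Real.log x ≤ 1 := hB.le.trans hcu1
      have hmin : min 1 ((1 - β₁) * Real.log x) = (1 - β₁) * Real.log x := min_eq_right hμ1
      have hsmall : 2 * C * n₀ * ((1 - β₁) * Real.log x) ≤ 1 / 3 := by
        have h1 : 2 * C * n₀ * ((1 - β₁) * Real.log x) ≤ 2 * C * n₀ * cu :=
          mul_le_mul_of_nonneg_left hB.le (by positivity)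
        have h2 : 2 * C * n₀ * cu ≤ 2 * C * n₀ * (1 / (6 * C * n₀)) :=
          mul_le_mul_of_nonneg_left hcuC (by positivity)
        have h3 : 2 * C * n₀ * (1 / (6 * C * n₀)) = 1 / 3 := by field_simp; ring
        linarith
      have hL4 : 4 ≤ Real.log x := by linarith
      set cZ : ℝ := min (Real.log (1 / (2 * C * n₀ * ((1 - β₁) * Real.log x))) / (C * n₀))
          (a * Real.log (ThornerZaman.condQn N) / 2) with hcZ
      have hcZ0 : 0 < cZ := by
        refine lt_min (div_pos (Real.log_pos ?_) (by positivity)) (by positivity)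
        have h0 : 0 < 2 * C * n₀ * ((1 - β₁) * Real.log x) := by positivity
        rw [lt_div_iff₀ h0]; linarith
      have hzfr_x := zfr_of_zeroRepulsion (K := N) hn₀ hNn hC (c := c) (a := a) ha hexcβ hβ1 hQx hL4 hrep hsmall
      have hzfr : ∀ (ψ : AddChar (Additive (ClassGroup (𝓞 N))) ℂ) (ρ : ℂ), famF N ψ ρ = 0 →
          1 / 4 ≤ ρ.re → ρ.re < 1 → |ρ.im| ≤ Real.exp (θ * (hi + ε)) → ¬ excRegion c N ρ →
            ρ.re ≤ 1 - cZ / (a * Real.log (ThornerZaman.condQn N) + Real.log (|ρ.im| + 4)) :=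
        fun ψ ρ h0 h14 h1 hγ hexc ↦ hzfr_x ψ ρ h0 h14 h1 (hγ.trans hT₁x) hexc
      have key := hcore cZ hcZ0 hzfr cc hcc Exc hExc0 hExcj hExc'
      rw [hcorr'] at key
      refine key.trans ?_
      rw [hmin]
      have hflatB := dh_flat_le (Q := ThornerZaman.condQn N) (μ₁ := (1 - β₁) * Real.log x) hC hn2 hD ha hθ0 htB0 hc₁
        hQ12 hμ0 hμlow hsmall hθK₃' hθK₄'
      have h1 : (n₀ : ℝ) * (9 / 2 * (2 * Real.exp 1 * D * Real.exp (-(cZ / (6 * θ))))) ≤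
          κ / 2 * ((1 - β₁) * Real.log x) := by
        have := mul_le_mul_of_nonneg_left hflatB (by positivity : (0 : ℝ) ≤ (n₀ : ℝ) * (9 / 2))
        have e : (n₀ : ℝ) * (9 / 2) * (tB * ((1 - β₁) * Real.log x)) = κ / 2 * ((1 - β₁) * Real.log x) := by
          rw [htB]; field_simp
        rw [hcZ]; linarith
      have h2 : κ * c₁ / 2 * ThornerZaman.condQn N ^ (-(2 : ℝ)) ≤ κ / 2 * ((1 - β₁) * Real.log x) := by
        have := mul_le_mul_of_nonneg_left hμlow (by positivity : (0:ℝ) ≤ κ / 2)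
        linarith
      have hsum : (n₀ : ℝ) * (9 / 2 * (2 * Real.exp 1 * D * Real.exp (-(cZ / (6 * θ))))) +
          κ * c₁ / 2 * ThornerZaman.condQn N ^ (-(2 : ℝ)) ≤ κ * ((1 - β₁) * Real.log x) := by linarith
      have := mul_le_mul_of_nonneg_right (mul_le_mul_of_nonneg_right hsum hx0.le) hη0.le
      refine this.trans (le_of_eq ?_)
      ring

end Summit.QuantumAdvantage.QuantumAdvantage.Theorems.DegreeOnePrimesEscape

end
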